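import Literature.MathematicalPhysics.KineticTheory.HierarchyPruningEstimates
import Literature.MathematicalPhysics.KineticTheory.TaggedBoltzmannPruning
import HarnessLib

/-!
# The finite Duhamel series of a hierarchy and the pruned expansion up to null sets
(Bodineau–Gallagher–Saint-Raymond, Invent. Math. 203 (2016) = arXiv:1305.3397v2, §3.1 (the
iterated Duhamel formula and Remark 3.1, p. 9), §4.3–4.4 (4.4)–(4.17), pp. 12–14; trunk T-KINETIC, topic
MathematicalPhysics/KineticTheory; layer "A1-algebra" of the bottom-up plan towards the named fact
`bgsr_theorem22` / fact (c) `bodineau_gallagher_saintRaymond_linear` recorded in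
`TaggedSphereLinearBoltzmann`.)

BGSR §3.1 (p. 9) write the BBGKY hierarchy of the `N`-sphere system in integrated form, "the
iterated Duhamel formula `f_N^{(s)}(t) = ∑_{n=0}^{N-s} αⁿ ∫_0^t ∫_0^{t_1} ⋯ ∫_0^{t_{n-1}} S_s(t - t_1)
C_{s,s+1} S_{s+1}(t_1 - t_2) C_{s+1,s+2} ⋯ S_{s+n}(t_n) f_N^{(s+n)}(0) dt_n ⋯ dt_1`", i.e. as the
*finite* Duhamel series `∑_{n=0}^{N-s} αⁿ Q_{s,s+n}(t) f_N^{(s+n)}(0)` of the initial marginals, and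
add (Remark 3.1: "It is not obvious that formula (iterated Duhamel) makes sense since the
transport operator `S_{s+1}` is defined only for almost all initial configurations, and the
collision operator `C_{s,s+1}` is defined by some integrals on manifolds of codimension 1. This
fact is analyzed in [Simonella] and in the erratum of [GSRT]") that giving it a rigorous sense for
the hard-sphere flow is a separate matter. This file isolates the ALGEBRA of that formula
for an abstract hierarchy `M` (`Kinetic.HierarchyModel`, N4a) whose transports form one-parameter
groups on the whole phase space:

* `Kinetic.HierarchyModel.seriesFamily M Nmax f₀` — the finite Duhamel series
  `F^{(s)}(t) := ∑_{n ≤ Nmax} Q_{s,s+n}(t) f₀` of a nice initial family `f₀` vanishing above level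
  `Nmax` (for the `N`-sphere system `Nmax = N`: the prefactor `N - s` of `C_{s,s+1}` and the
  marginals both vanish above `N`);
* `seriesFamily_duhamel_zero`, `isMildSolution_seriesFamily` — **the series is a two-time mild
  solution** of `M` on every `[0, T]` (BGSR (3.3) restarted from any intermediate time, the form
  consumed by the pruning algebra of N4a): a purely algebraic fact (unfolding of `duhamelTerm`,
  additivity of the Duhamel step on nice densities, and `isMildSolution_of_duhamel_zero` of A2,
  which uses the group law of the transports everywhere);
* `iterRem_seriesFamily` — for this solution the remainder of the `n`-fold Duhamel iteration over a
  block (N4a `iterRem`, BGSR's `R_{s,n}(t', t'+h)`) IS the tail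
  `∑_{n ≤ m ≤ Nmax} Q_{s,s+m}(h) F(t')` of the block's Duhamel series ("`R_{1,n_1}` accounts for at
  least `n_1` collisions", BGSR (4.4)) — `Kinetic.HierarchyModel.tailOp`;
* `Kinetic.HierarchyModel.RespectsAE M μ` — the Duhamel terms of `M` respect `μ`-a.e. equality of
  nice families (true, but not formal, for the hard-sphere BBGKY hierarchy with the Liouville
  measures: it is the non-singularity of the collision parametrisation, cf. Remark 3.1);
  `blockOp_congr_ae`, `blockComp_congr_ae`, `tailOp_congr_ae`;
* `seriesFamily_ae_eq_blockComp_add` — **the pruned expansion (4.8)–(4.9) up to null sets**: if at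
  the block times `t - kh` the series family agrees `μ`-a.e. with another nice family `P` (for hard
  spheres: the marginals of the transported density, BGSR's `f_N^{(s)}(t - kh)`, which obey the
  maximum principle (4.6) EVERYWHERE), then `μ`-a.e.
  `F^{(1)}(t) = f^{(1,K)}(t) + ∑_k Q ⋯ Q [tail remainders built on P(t - kh)]`;
* `abs_blockComp_tailOp_le`, `abs_tailRemainder_le`, `seriesFamily_ae_abs_sub_blockComp_le` —
  **BGSR Proposition 4.3 for the series family, almost everywhere**: with thresholds `n_k = A^k`,
  `γ ≤ 1/2` and the step condition `C₀ c_R h ≤ γ/e²` of N4b, `|F^{(1)}(Kh) - f^{(1,K)}(Kh)| ≤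
  4 γ^A R₀ C₀` `μ`-almost everywhere, the a priori bound `|P^{(k)}(τ)| ≤ R₀ C₀^k e^{-β H_k}` being
  required of `P` only (tails of Duhamel series over one block cost a factor `2`, whence `4 γ^A`
  in place of N4b's `2 γ^A`).

For the hard-sphere system this reduces the BBGKY side of BGSR Theorem 2.2 to two inputs about
the concrete flow, both outside this file: the identification of the marginals of the transported
density with the finite Duhamel series up to Liouville-null sets (the iterated Duhamel formula,
Simonella 2014 / GSRT 2013 Part II) and `RespectsAE` for the Liouville measures.

## References

* T. Bodineau, I. Gallagher, L. Saint-Raymond, *The Brownian motion as the limit of a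
  deterministic system of hard-spheres*, Invent. Math. 203 (2016) 493–553 = arXiv:1305.3397v2,
  §3.1 (iterated Duhamel formula, operators `Q_{s,s+n}`, Remark 3.1), p. 9; §4.3–4.4,
  (4.4)–(4.17), Prop. 4.3, pp. 12–14 (equation numbers of §4 are those of the arXiv v2 TeX
  source, as in N4b `HierarchyPruningEstimates`; "p. N" = chunk N of `lit read arxiv:1305.3397`).
* S. Simonella, *Evolution of correlation functions in the hard sphere dynamics*, J. Stat. Phys.
  155 (2014) 1191–1221 (arXiv:1205.2789), for the rigorous series expansion.
* I. Gallagher, L. Saint-Raymond, B. Texier, *From Newton to Boltzmann* (2013), §4.3–4.4.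
-/

open MeasureTheory Metric Real Set Filter Function
open scoped Nat
open Literature.Analysis.FluidPDE (Config configEnergy GCState duhamelTerm duhamelTerm_zero
  duhamelTerm_succ)

namespace Literature.MathematicalPhysics.KineticTheory

noncomputable section

section Kinetic

variable {d : Type*} [Fintype d] {X : Type*} [MeasurableSpace X]

namespace HierarchyModel

variable (M : HierarchyModel d X)

/-! ## The finite Duhamel series of an initial family -/

section Series

/-- The finite Duhamel series of the initial family `f₀`, truncated at order `Nmax`:
`F^{(s)}(t) = ∑_{n=0}^{Nmax} Q_{s,s+n}(t) f₀` — the right-hand side of BGSR's iterated Duhamel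
formula, §3.1 (`Nmax = N - s` there, and the rate `αⁿ` is inside `M.op`; terms with `s + n > Nmax`
vanish when `f₀` does above level `Nmax`, `duhamelTerm_eq_zero_of_lt`, so the truncation order may
be taken independent of `s`). [cite: BodineauGallagherSaintRaymondInvent2016, §3.1, p. 9] -/
def seriesFamily (Nmax : ℕ) (f₀ : GCState d X) (s : ℕ) (t : ℝ) (Z : Config s d X) : ℝ :=
  ∑ n ∈ Finset.range (Nmax + 1), duhamelTerm M.transport M.op n s t f₀ Z

/-- Unfolding lemma for the series family. [folklore] -/
theorem seriesFamily_apply (Nmax : ℕ) (f₀ : GCState d X) (s : ℕ) (t : ℝ) (Z : Config s d X) :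
    M.seriesFamily Nmax f₀ s t Z =
      ∑ n ∈ Finset.range (Nmax + 1), duhamelTerm M.transport M.op n s t f₀ Z := rfl

variable {M}

/-- Duhamel terms reaching above the top level vanish: if `f₀^{(k)} = 0` for `k > Nmax` then
`Q_{s,s+n}(t) f₀ = 0` whenever `s + n > Nmax` (induction on `n`: the innermost slot is
`S_{s+n} f₀^{(s+n)} = 0`, and `C_s 0 = 0`). [folklore] -/
theorem duhamelTerm_eq_zero_of_lt {Nmax : ℕ} {f₀ : GCState d X} (hvan : ∀ k, Nmax < k → f₀ k = 0)
    (n : ℕ) : ∀ (s : ℕ) (t : ℝ), Nmax < s + n → ∀ Z : Config s d X,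
      duhamelTerm M.transport M.op n s t f₀ Z = 0 := by
  induction n with
  | zero =>
    intro s t hs Z
    rw [duhamelTerm_zero, M.transport_apply, hvan s (by simpa using hs)]
    rfl
  | succ n ih =>
    intro s t hs Z
    rw [duhamelTerm_succ]
    have hfun : ∀ τ : ℝ, duhamelTerm M.transport M.op n (s + 1) τ f₀ = 0 := by
      intro τ
      funext Z'
      exact ih (s + 1) τ (by omega) Z'
    simp only [hfun, M.op_zero, M.transport_apply, Pi.zero_apply, intervalIntegral.integral_zero]

/-- The series family vanishes above the top level. [folklore] -/
theorem seriesFamily_eq_zero_of_lt {Nmax : ℕ} {f₀ : GCState d X} (hvan : ∀ k, Nmax < k → f₀ k = 0)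
    {s : ℕ} (hs : Nmax < s) (t : ℝ) (Z : Config s d X) : M.seriesFamily Nmax f₀ s t Z = 0 := by
  rw [seriesFamily_apply]
  exact Finset.sum_eq_zero fun n _ => duhamelTerm_eq_zero_of_lt hvan n s t (by omega) Z

/-- The top term of the series at level `s + 1` vanishes, so that
`F^{(s+1)}(τ) = ∑_{n < Nmax} Q_{s+1,s+1+n}(τ) f₀`. [folklore] -/
theorem seriesFamily_succ_eq {Nmax : ℕ} {f₀ : GCState d X} (hvan : ∀ k, Nmax < k → f₀ k = 0)
    (s : ℕ) (τ : ℝ) :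
    M.seriesFamily Nmax f₀ (s + 1) τ =
      ∑ n ∈ Finset.range Nmax, duhamelTerm M.transport M.op n (s + 1) τ f₀ := by
  funext Z
  rw [seriesFamily_apply, Finset.sum_range_succ, duhamelTerm_eq_zero_of_lt hvan Nmax (s + 1) τ
    (by omega) Z, add_zero, Finset.sum_apply]

/-- **The series family is in the Lanford class**, uniformly on every `[0, T]` (finite sum of
`isNiceT_duhamelTerm`). [folklore] -/
theorem isNiceT_seriesFamily {f₀ : GCState d X} (hf₀ : ∀ k, IsNice (f₀ k)) (Nmax : ℕ) (T : ℝ)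
    (s : ℕ) : IsNiceT T (M.seriesFamily Nmax f₀ s) := by
  have h := IsNiceT.sum (T := T) (Finset.range (Nmax + 1))
    (u := fun n t => duhamelTerm M.transport M.op n s t f₀)
    fun n _ => isNiceT_duhamelTerm M hf₀ n s
  convert h using 1
  funext t Z
  simp [seriesFamily_apply, Finset.sum_apply]

/-- Each time slice of the series family is nice. [folklore] -/
theorem isNice_seriesFamily {f₀ : GCState d X} (hf₀ : ∀ k, IsNice (f₀ k)) (Nmax s : ℕ) {t : ℝ}
    (ht : 0 ≤ t) : IsNice (M.seriesFamily Nmax f₀ s t) :=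
  (isNiceT_seriesFamily hf₀ Nmax t s).isNice ⟨ht, le_rfl⟩

/-- At time `0` the series family is `f₀ ∘ Φ_0` (only the transport term survives; for flows with
`Φ_0 = id` this is `f₀`, `seriesFamily_zero_of_flow_zero`). [folklore] -/
theorem seriesFamily_zero (Nmax : ℕ) (f₀ : GCState d X) (s : ℕ) (Z : Config s d X) :
    M.seriesFamily Nmax f₀ s 0 Z = f₀ s (M.flow s 0 Z) := by
  rw [seriesFamily_apply, Finset.sum_range_succ', duhamelTerm_zero, M.transport_apply, neg_zero]
  have h0 : ∀ n ∈ Finset.range Nmax, duhamelTerm M.transport M.op (n + 1) s 0 f₀ Z = 0 := by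
    intro n _
    rw [duhamelTerm_succ, intervalIntegral.integral_same]
  rw [Finset.sum_eq_zero h0, zero_add]

/-- At time `0` the series family is `f₀` when `Φ_0 = id`. [folklore] -/
theorem seriesFamily_zero_of_flow_zero (hflow0 : ∀ (s : ℕ) (Z : Config s d X), M.flow s 0 Z = Z)
    (Nmax : ℕ) (f₀ : GCState d X) (s : ℕ) : M.seriesFamily Nmax f₀ s 0 = f₀ s := by
  funext Z
  rw [seriesFamily_zero, hflow0]

/-- **The series solves the mild hierarchy from time `0`** (the mild form of the hierarchy of
BGSR §3.1, for its iterated Duhamel formula):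
`F^{(s)}(t) = S_s(t) F^{(s)}(0) + ∫_0^t S_s(t - τ) C_s F^{(s+1)}(τ) dτ` for `t ≥ 0`, at every point —
split off the order-`0` term, unfold `duhamelTerm_succ` in the others, and exchange the finite
sum with the Duhamel step (`duhamelStep_finset_sum`); the group law of the transports turns
`S_s(t) (f₀ ∘ Φ_0)` into `S_s(t) f₀`. [cite: BodineauGallagherSaintRaymondInvent2016, §3.1, p. 9] -/
theorem seriesFamily_duhamel_zero
    (hflow : ∀ (s : ℕ) (a b : ℝ) (Z : Config s d X), M.flow s (a + b) Z = M.flow s a (M.flow s b Z))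
    {Nmax : ℕ} {f₀ : GCState d X} (hf₀ : ∀ k, IsNice (f₀ k)) (hvan : ∀ k, Nmax < k → f₀ k = 0)
    (s : ℕ) {t : ℝ} (ht : 0 ≤ t) (Z : Config s d X) :
    M.seriesFamily Nmax f₀ s t Z =
      M.transport s t (M.seriesFamily Nmax f₀ s 0) Z +
        ∫ τ in (0 : ℝ)..t, M.transport s (t - τ) (M.op s (M.seriesFamily Nmax f₀ (s + 1) τ)) Z := by
  -- the transport term
  have h0 : M.transport s t (M.seriesFamily Nmax f₀ s 0) Z = duhamelTerm M.transport M.op 0 s t f₀ Z := by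
    rw [M.transport_apply, seriesFamily_zero, duhamelTerm_zero, M.transport_apply, ← hflow, zero_add]
  -- the collision terms
  have hQ : ∀ n, IsNiceT t (fun τ => duhamelTerm M.transport M.op n (s + 1) τ f₀) :=
    fun n => isNiceT_duhamelTerm M hf₀ n (s + 1)
  have h1 : ∫ τ in (0 : ℝ)..t, M.transport s (t - τ) (M.op s (M.seriesFamily Nmax f₀ (s + 1) τ)) Z =
      ∑ n ∈ Finset.range Nmax, duhamelTerm M.transport M.op (n + 1) s t f₀ Z := by
    simp only [seriesFamily_succ_eq hvan]
    rw [duhamelStep_finset_sum M (Finset.range Nmax) (fun n _ => hQ n) ⟨ht, le_rfl⟩ Z]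
    simp only [duhamelTerm_succ]
  rw [h0, h1, seriesFamily_apply, Finset.sum_range_succ']
  ring

/-- **The finite Duhamel series is a two-time mild solution** of the hierarchy on every `[0, T]`
(N4a `IsMildSolution`: `F^{(s)}(t'+h) = S_s(h) F^{(s)}(t') + ∫_0^h S_s(h-τ) C_s F^{(s+1)}(t'+τ) dτ`
at every point), for a model whose transports form one-parameter groups on the whole phase space
(`seriesFamily_duhamel_zero` and A2's `isMildSolution_of_duhamel_zero`). This is the form of the
hierarchy used in BGSR §4.3 ("iterating Duhamel's formula up to time `t - h` instead of time
`0`"). [cite: BodineauGallagherSaintRaymondInvent2016, §3.1, p. 9; §4.3 (4.4), p. 12] -/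
theorem isMildSolution_seriesFamily
    (hflow : ∀ (s : ℕ) (a b : ℝ) (Z : Config s d X), M.flow s (a + b) Z = M.flow s a (M.flow s b Z))
    {Nmax : ℕ} {f₀ : GCState d X} (hf₀ : ∀ k, IsNice (f₀ k)) (hvan : ∀ k, Nmax < k → f₀ k = 0)
    (T : ℝ) : M.IsMildSolution T (M.seriesFamily Nmax f₀) :=
  M.isMildSolution_of_duhamel_zero hflow (fun s => isNiceT_seriesFamily hf₀ Nmax T s)
    fun s _ ht Z => seriesFamily_duhamel_zero hflow hf₀ hvan s ht.1 Z

end Series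

/-! ## Tails of the Duhamel series over one block -/

section Tail

/-- The tail operator of one block: `G ↦ (∑_{n ≤ m ≤ Nmax} Q_{a,a+m}(h) G)_a` — the pseudo-
trajectories of the block with at least `n` creations (BGSR (4.4): "`R_{1,n_1}` accounts for at
least `n_1` collisions"), for families whose Duhamel series terminates at order `Nmax`.
[cite: BodineauGallagherSaintRaymondInvent2016, §4.3 (4.4), p. 12] -/
def tailOp (n Nmax : ℕ) (h : ℝ) (G : GCState d X) : GCState d X :=
  fun a Z => ∑ m ∈ Finset.Ico n (Nmax + 1), duhamelTerm M.transport M.op m a h G Z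

/-- Unfolding lemma for the tail operator. [folklore] -/
theorem tailOp_apply (n Nmax : ℕ) (h : ℝ) (G : GCState d X) (a : ℕ) (Z : Config a d X) :
    M.tailOp n Nmax h G a Z = ∑ m ∈ Finset.Ico n (Nmax + 1), duhamelTerm M.transport M.op m a h G Z :=
  rfl

variable {M}

/-- Tails of nice families are nice (`h ≥ 0`). [folklore] -/
theorem isNice_tailOp {G : GCState d X} (hG : ∀ k, IsNice (G k)) (n Nmax : ℕ) {h : ℝ} (hh : 0 ≤ h)
    (a : ℕ) : IsNice (M.tailOp n Nmax h G a) := by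
  have := IsNice.sum (Finset.Ico n (Nmax + 1)) (g := fun m => duhamelTerm M.transport M.op m a h G)
    fun m _ => isNice_duhamelTerm M hG m a hh
  convert this using 1
  funext Z
  simp [tailOp_apply, Finset.sum_apply]

/-- The block operator plus the tail operator is the full (finite) Duhamel series of the block.
[folklore] -/
theorem blockOp_add_tailOp {n Nmax : ℕ} (hn : n ≤ Nmax + 1) (h : ℝ) (G : GCState d X) (a : ℕ)
    (Z : Config a d X) :
    M.blockOp n h G a Z + M.tailOp n Nmax h G a Z =
      ∑ m ∈ Finset.range (Nmax + 1), duhamelTerm M.transport M.op m a h G Z := by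
  rw [blockOp_apply, tailOp_apply]
  simp only [Finset.range_eq_Ico]
  exact Finset.sum_Ico_consecutive _ (Nat.zero_le n) hn

/-- The remainders of the series family above the top level vanish: `iterRem m a h = 0` whenever
`a + m > Nmax` (its innermost slot is `F^{(a+m)} = 0`). [folklore] -/
theorem iterRem_seriesFamily_eq_zero {Nmax : ℕ} {f₀ : GCState d X}
    (hvan : ∀ k, Nmax < k → f₀ k = 0) (t' : ℝ) (m : ℕ) :
    ∀ (a : ℕ) (h : ℝ), Nmax < a + m → ∀ Z : Config a d X,
      M.iterRem (M.seriesFamily Nmax f₀) t' m a h Z = 0 := by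
  induction m with
  | zero =>
    intro a h ha Z
    rw [M.iterRem_zero]
    exact seriesFamily_eq_zero_of_lt hvan (by simpa using ha) _ Z
  | succ m ih =>
    intro a h ha Z
    rw [M.iterRem_succ]
    have hfun : ∀ τ : ℝ, M.iterRem (M.seriesFamily Nmax f₀) t' m (a + 1) τ = 0 := by
      intro τ
      funext Z'
      exact ih (a + 1) τ (by omega) Z'
    simp only [hfun, M.op_zero, M.transport_apply, Pi.zero_apply, intervalIntegral.integral_zero]

/-- **The remainder of a block is the tail of its Duhamel series.** For the series family (group
law everywhere, `f₀` nice and vanishing above `Nmax`), `0 ≤ t'`, `0 ≤ h`: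
`iterRem n a h = ∑_{n ≤ m ≤ Nmax} Q_{a,a+m}(h) F(t')` at every point — `iterRem_spec` (N4a) at the
orders `n` and `Nmax + 1`, the remainder of order `Nmax + 1` being zero. This identifies N4a's
finite-iteration remainder with BGSR's "trajectories with at least `n_k` collisions during the
block" for hierarchies with finitely many levels. [cite: BodineauGallagherSaintRaymondInvent2016, §4.3 (4.4)-(4.6), pp. 12–13] -/
theorem iterRem_seriesFamily
    (hflow : ∀ (s : ℕ) (a b : ℝ) (Z : Config s d X), M.flow s (a + b) Z = M.flow s a (M.flow s b Z))
    {Nmax : ℕ} {f₀ : GCState d X} (hf₀ : ∀ k, IsNice (f₀ k)) (hvan : ∀ k, Nmax < k → f₀ k = 0)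
    {t' : ℝ} (ht' : 0 ≤ t') (n a : ℕ) {h : ℝ} (hh : 0 ≤ h) (Z : Config a d X) :
    M.iterRem (M.seriesFamily Nmax f₀) t' n a h Z =
      M.tailOp n Nmax h (fun k => M.seriesFamily Nmax f₀ k t') a Z := by
  have hF := isMildSolution_seriesFamily hflow hf₀ hvan (t' + h)
  have hhI : h ∈ Icc 0 (t' + h - t') := ⟨hh, by linarith⟩
  have hspec_n := hF.iterRem_eq_sub ht' (by linarith) n a hhI Z
  have hspec_top := hF.iterRem_spec ht' (by linarith) (Nmax + 1) a h hhI Z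
  rw [iterRem_seriesFamily_eq_zero hvan t' (Nmax + 1) a h (by omega) Z, add_zero] at hspec_top
  rw [hspec_n, hspec_top, tailOp_apply]
  simp only [Finset.range_eq_Ico]
  rcases le_or_gt n (Nmax + 1) with hn | hn
  · rw [← Finset.sum_Ico_consecutive _ (Nat.zero_le n) hn]
    ring
  · -- above the top: both sides vanish
    have hIco : Finset.Ico n (Nmax + 1) = ∅ := Finset.Ico_eq_empty_of_le hn.le
    rw [hIco, Finset.sum_empty, ← Finset.sum_Ico_consecutive _ (Nat.zero_le (Nmax + 1)) hn.le]
    have hzero : ∑ m ∈ Finset.Ico (Nmax + 1) n,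
        duhamelTerm M.transport M.op m a h (fun k => M.seriesFamily Nmax f₀ k t') Z = 0 := by
      refine Finset.sum_eq_zero fun m hm => ?_
      have hm' : Nmax + 1 ≤ m := (Finset.mem_Ico.1 hm).1
      -- the spec at the orders `m` and `m + 1`, whose remainders both vanish
      have h1 := hF.iterRem_spec ht' (by linarith) m a h hhI Z
      have h2 := hF.iterRem_spec ht' (by linarith) (m + 1) a h hhI Z
      rw [iterRem_seriesFamily_eq_zero hvan t' m a h (by omega) Z, add_zero] at h1
      rw [iterRem_seriesFamily_eq_zero hvan t' (m + 1) a h (by omega) Z, add_zero,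
        Finset.sum_range_succ, ← h1] at h2
      linarith
    rw [hzero]
    ring

end Tail

/-! ## Hierarchies whose Duhamel terms respect null sets -/

section AE

/-- The Duhamel terms of the model `M` *respect `μ`-null sets*: nice families that agree
`μ_k`-almost everywhere at every level `k` have `μ_s`-a.e. equal Duhamel terms `Q_{s,s+n}(h)`.
For the hard-sphere BBGKY hierarchy with the Liouville measures this is NOT formal — the
collision operator `C_{s,s+1}` reads its argument on the contact set, a Lebesgue-null subset of
the `(s+1)`-particle phase space (BGSR Remark 3.1) — but true, by the non-singularity of the
parametrisation of pseudo-trajectories by creation times, impact vectors and velocities (the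
argument of `C_{s,s+1}` inside `Q_{s,s+n}` is always transported backwards over an integrated
time first). Here it is the hypothesis under which the a priori bound may be transferred from the
marginals to their Duhamel series. [cite: BodineauGallagherSaintRaymondInvent2016, §3.1 Remark 3.1, p. 9] -/
def RespectsAE (μ : (s : ℕ) → Measure (Config s d X)) : Prop :=
  ∀ (n s : ℕ) {h : ℝ}, 0 ≤ h → ∀ {G₁ G₂ : GCState d X}, (∀ k, IsNice (G₁ k)) → (∀ k, IsNice (G₂ k)) →
    (∀ k, G₁ k =ᵐ[μ k] G₂ k) →
      duhamelTerm M.transport M.op n s h G₁ =ᵐ[μ s] duhamelTerm M.transport M.op n s h G₂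

variable {M}

/-- Sanity check of the definition: every model respects the null sets of the zero measures.
[folklore] -/
theorem respectsAE_zero : M.RespectsAE (fun s => (0 : Measure (Config s d X))) :=
  fun _ _ _ _ _ _ _ _ _ => by simp [EventuallyEq, ae_zero]

variable {μ : (s : ℕ) → Measure (Config s d X)}

/-- Blocks respect null sets. [folklore] -/
theorem blockOp_congr_ae (hR : M.RespectsAE μ) (n : ℕ) {h : ℝ} (hh : 0 ≤ h) {G₁ G₂ : GCState d X}
    (h₁ : ∀ k, IsNice (G₁ k)) (h₂ : ∀ k, IsNice (G₂ k)) (hae : ∀ k, G₁ k =ᵐ[μ k] G₂ k) (a : ℕ) :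
    M.blockOp n h G₁ a =ᵐ[μ a] M.blockOp n h G₂ a := by
  have hall : ∀ᵐ Z ∂(μ a), ∀ j ∈ Finset.range n,
      duhamelTerm M.transport M.op j a h G₁ Z = duhamelTerm M.transport M.op j a h G₂ Z :=
    (Filter.eventually_all_finset _).2 fun j _ => hR j a hh h₁ h₂ hae
  filter_upwards [hall] with Z hZ
  simp only [blockOp_apply]
  exact Finset.sum_congr rfl hZ

/-- Tails respect null sets. [folklore] -/
theorem tailOp_congr_ae (hR : M.RespectsAE μ) (n Nmax : ℕ) {h : ℝ} (hh : 0 ≤ h) {G₁ G₂ : GCState d X}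
    (h₁ : ∀ k, IsNice (G₁ k)) (h₂ : ∀ k, IsNice (G₂ k)) (hae : ∀ k, G₁ k =ᵐ[μ k] G₂ k) (a : ℕ) :
    M.tailOp n Nmax h G₁ a =ᵐ[μ a] M.tailOp n Nmax h G₂ a := by
  have hall : ∀ᵐ Z ∂(μ a), ∀ j ∈ Finset.Ico n (Nmax + 1),
      duhamelTerm M.transport M.op j a h G₁ Z = duhamelTerm M.transport M.op j a h G₂ Z :=
    (Filter.eventually_all_finset _).2 fun j _ => hR j a hh h₁ h₂ hae
  filter_upwards [hall] with Z hZ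
  simp only [tailOp_apply]
  exact Finset.sum_congr rfl hZ

/-- Composites of blocks respect null sets. [folklore] -/
theorem blockComp_congr_ae (hR : M.RespectsAE μ) (nseq : ℕ → ℕ) {h : ℝ} (hh : 0 ≤ h) (k : ℕ) :
    ∀ {G₁ G₂ : GCState d X}, (∀ a, IsNice (G₁ a)) → (∀ a, IsNice (G₂ a)) →
      (∀ a, G₁ a =ᵐ[μ a] G₂ a) → ∀ a, M.blockComp nseq h k G₁ a =ᵐ[μ a] M.blockComp nseq h k G₂ a := by
  induction k with
  | zero => intro G₁ G₂ _ _ hae a; simpa using hae a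
  | succ k ih =>
    intro G₁ G₂ h₁ h₂ hae a
    simp only [blockComp_succ]
    exact ih (fun a => isNice_blockOp h₁ (nseq k) hh a) (fun a => isNice_blockOp h₂ (nseq k) hh a)
      (fun a => blockOp_congr_ae hR (nseq k) hh h₁ h₂ hae a) a

/-- **The pruned expansion up to null sets (BGSR (4.8)–(4.9) for the series family).** Let the
transports of `M` form groups everywhere, `f₀` be nice and vanish above `Nmax`, and let the
Duhamel terms of `M` respect `μ`-null sets. If at each block time `t_i = Kh - (i+1)h`, `i < K`,
the series family `F` agrees `μ`-a.e., level by level, with a nice family `P(t_i)`, then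
`μ_1`-a.e.
`F^{(1)}(Kh) = (blockComp K [F(0)])^{(1)} + ∑_{i<K} (blockComp i [tailOp n_{i+1} [P(t_i)]])^{(1)}`:
the block expansion of N4a (`blockComp_spec`, everywhere), the identification of its remainders
with tails of Duhamel series (`iterRem_seriesFamily`, everywhere), and the exchange of `F(t_i)`
for `P(t_i)` inside the tails (`tailOp_congr_ae`, `blockComp_congr_ae`). For hard spheres `P` is
the family of marginals of the transported density, BGSR's `f_N^{(s)}(t - kh)`.
[cite: BodineauGallagherSaintRaymondInvent2016, §4.3 (4.8)-(4.9), p. 13] -/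
theorem seriesFamily_ae_eq_blockComp_add
    (hflow : ∀ (s : ℕ) (a b : ℝ) (Z : Config s d X), M.flow s (a + b) Z = M.flow s a (M.flow s b Z))
    {Nmax : ℕ} {f₀ : GCState d X} (hf₀ : ∀ k, IsNice (f₀ k)) (hvan : ∀ k, Nmax < k → f₀ k = 0)
    (hR : M.RespectsAE μ) (nseq : ℕ → ℕ) {h : ℝ} (hh : 0 ≤ h) (K : ℕ)
    {P : (s : ℕ) → ℝ → Config s d X → ℝ} (hP : ∀ i < K, ∀ k, IsNice (P k (K * h - (i + 1) * h)))
    (hS : ∀ i < K, ∀ k,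
      M.seriesFamily Nmax f₀ k (K * h - (i + 1) * h) =ᵐ[μ k] P k (K * h - (i + 1) * h)) :
    M.seriesFamily Nmax f₀ 1 (K * h) =ᵐ[μ 1] fun Z =>
      M.blockComp nseq h K (fun a => M.seriesFamily Nmax f₀ a 0) 1 Z +
        ∑ i ∈ Finset.range K, M.blockComp nseq h i
          (M.tailOp (nseq i) Nmax h (fun k => P k (K * h - (i + 1) * h))) 1 Z := by
  set F := M.seriesFamily Nmax f₀ with hFdef
  have hF : M.IsMildSolution (K * h) F := isMildSolution_seriesFamily hflow hf₀ hvan (K * h)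
  -- block times are nonnegative
  have hti : ∀ i < K, 0 ≤ K * h - (i + 1) * h := by
    intro i hi
    have : (i + 1 : ℝ) ≤ K := by exact_mod_cast hi
    nlinarith
  -- the remainders are tails, everywhere
  have hrem : ∀ i < K, (fun a Z => M.iterRem F (K * h - (i + 1) * h) (nseq i) a h Z) =
      M.tailOp (nseq i) Nmax h (fun k => F k (K * h - (i + 1) * h)) := by
    intro i hi
    funext a Z
    exact iterRem_seriesFamily hflow hf₀ hvan (hti i hi) (nseq i) a hh Z
  -- exchange `F(t_i)` for `P(t_i)` inside the tails, block by block
  have hall : ∀ᵐ Z ∂(μ 1), ∀ i ∈ Finset.range K,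
      M.blockComp nseq h i (M.tailOp (nseq i) Nmax h (fun k => F k (K * h - (i + 1) * h))) 1 Z =
        M.blockComp nseq h i (M.tailOp (nseq i) Nmax h (fun k => P k (K * h - (i + 1) * h))) 1 Z := by
    refine (Filter.eventually_all_finset _).2 fun i hi => ?_
    have hi' : i < K := Finset.mem_range.1 hi
    have hFn : ∀ k, IsNice (F k (K * h - (i + 1) * h)) := fun k => isNice_seriesFamily hf₀ Nmax k (hti i hi')
    exact blockComp_congr_ae hR nseq hh i (fun a => isNice_tailOp hFn (nseq i) Nmax hh a)
      (fun a => isNice_tailOp (hP i hi') (nseq i) Nmax hh a)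
      (fun a => tailOp_congr_ae hR (nseq i) Nmax hh hFn (hP i hi') (hS i hi') a) 1
  filter_upwards [hall] with Z hZ
  have hspec := hF.blockComp_spec nseq hh le_rfl K (by simp) 1 Z
  simp only [sub_self] at hspec
  rw [hspec]
  congr 1
  refine Finset.sum_congr rfl fun i hi => ?_
  rw [hrem i (Finset.mem_range.1 hi)]
  exact hZ i hi

end AE

/-! ## BGSR Proposition 4.3 with tail remainders -/

section Estimates

variable {M}

/-- Geometric tails: for `0 ≤ r ≤ 1/2`, `∑_{n ≤ m < N'} r^m ≤ 2 r^n`. [folklore] -/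
theorem geom_sum_Ico_le_two_mul {r : ℝ} (hr0 : 0 ≤ r) (hr : r ≤ 1 / 2) (n N' : ℕ) :
    ∑ m ∈ Finset.Ico n N', r ^ m ≤ 2 * r ^ n := by
  have h := geom_sum_Ico_le_of_lt_one hr0 (hr.trans_lt (by norm_num)) (m := n) (n := N')
  refine h.trans ?_
  rw [div_le_iff₀ (by linarith)]
  nlinarith [pow_nonneg hr0 n]

/-- **One Duhamel term of a block under the a priori bound** (the estimate (4.16) of BGSR, one
order at a time): if `|G^{(k)}| ≤ R₀ C₀^k e^{-β H_k}` at all levels, then for `m ≥ 1`, `L ≤ m`,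
`a ≤ L`, `h ≥ 0`, `|Q_{a,a+m}(h) G (Z)| ≤ R₀ C₀^a (e x)^m e^{-(3β/4) H(Z)}` with `x = C₀ c_R h`
(`c_R = pruneConst`): the chain estimate of N3 with floor `β/2` and decrement `β/4m` on each of the
`m` collision operators (`chainCost_le`: each costs `c_R m`), and `m^m/m! ≤ e^m`.
[cite: BodineauGallagherSaintRaymondInvent2016, §4.4 (4.16), p. 13] -/
theorem abs_duhamelTerm_le_exp_mul_pow {G : GCState d X} {R₀ C₀ β : ℝ} (hR₀ : 0 ≤ R₀) (hC₀ : 1 ≤ C₀)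
    (hβ : 0 < β) (hGb : ∀ (k : ℕ) (Z : Config k d X), |G k Z| ≤ R₀ * C₀ ^ k * exp (-β * configEnergy Z))
    {L m : ℕ} (hm : 1 ≤ m) (hLm : L ≤ m) {a : ℕ} (ha : a ≤ L) {h : ℝ} (hh : 0 ≤ h) (Z : Config a d X) :
    |duhamelTerm M.transport M.op m a h G Z| ≤
      R₀ * C₀ ^ a * (exp 1 * (C₀ * M.pruneConst β * h)) ^ m * exp (-(3 * β / 4) * configEnergy Z) := by
  have hC₀0 : 0 ≤ C₀ := zero_le_one.trans hC₀
  have hm0 : (0 : ℝ) < m := by exact_mod_cast hm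
  have hδ : 0 < β / 4 / m := by positivity
  have hbm : 0 < β / 2 := by positivity
  have hb₀ : β / 2 ≤ 3 * β / 4 := by linarith
  have hK : 0 ≤ R₀ * C₀ ^ (a + m) := by positivity
  have hin : ∀ Z' : Config (a + m) d X, |G (a + m) Z'| ≤
      R₀ * C₀ ^ (a + m) * exp (-(3 * β / 4 + m * (β / 4 / m)) * configEnergy Z') := by
    intro Z'
    have hw : 3 * β / 4 + m * (β / 4 / m) = β := by
      field_simp
      ring
    rw [hw]
    exact hGb (a + m) Z'
  have hest := abs_duhamelTerm_le_weighted M.transport_energy M.opConst_nonneg M.op_weighted hbm hδ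
    (L + m) m a (by omega) hb₀ hK G hin hh Z
  refine hest.trans ?_
  change R₀ * C₀ ^ (a + m) * M.chainCost (β / 2) (β / 4 / m) (L + m) ^ m * h ^ m / m ! *
      exp (-(3 * β / 4) * configEnergy Z) ≤ _
  -- each collision operator costs `c_R m`
  have hΛ : M.chainCost (β / 2) (β / 4 / m) (L + m) ≤ M.pruneConst β * m * 1 := by
    refine M.chainCost_le hβ le_rfl hm0 (by simp) ?_
    push_cast
    have : (L : ℝ) ≤ m := by exact_mod_cast hLm
    linarith
  have hΛ0 : 0 ≤ M.chainCost (β / 2) (β / 4 / m) (L + m) := M.chainCost_nonneg _ _ _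
  have hcR := M.pruneConst_nonneg β
  set x := C₀ * M.pruneConst β * h with hx
  have hx0 : 0 ≤ x := by positivity
  have hst : (m : ℝ) ^ m / m ! ≤ exp 1 ^ m := by
    have := Real.pow_div_factorial_le_exp (x := (m : ℝ)) (Nat.cast_nonneg m) m
    rwa [← Real.exp_one_pow] at this
  have hE : 0 ≤ exp (-(3 * β / 4) * configEnergy Z) := (exp_pos _).le
  calc R₀ * C₀ ^ (a + m) * M.chainCost (β / 2) (β / 4 / m) (L + m) ^ m * h ^ m / m ! *
        exp (-(3 * β / 4) * configEnergy Z)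
      ≤ R₀ * C₀ ^ (a + m) * (M.pruneConst β * m * 1) ^ m * h ^ m / m ! *
          exp (-(3 * β / 4) * configEnergy Z) := by gcongr
    _ = R₀ * C₀ ^ a * x ^ m * ((m : ℝ) ^ m / m !) * exp (-(3 * β / 4) * configEnergy Z) := by
        rw [hx, pow_add, mul_pow, mul_pow, mul_pow, mul_pow]
        ring
    _ ≤ R₀ * C₀ ^ a * x ^ m * exp 1 ^ m * exp (-(3 * β / 4) * configEnergy Z) := by gcongr
    _ = R₀ * C₀ ^ a * (exp 1 * x) ^ m * exp (-(3 * β / 4) * configEnergy Z) := by rw [mul_pow]; ring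

/-- **The tail of a block under the a priori bound**: with `x = C₀ c_R h` and `e x ≤ 1/2`, at
every level `a ≤ L ≤ n`, `n ≥ 1`,
`|(tailOp n Nmax h G)^{(a)}(Z)| ≤ 2 R₀ (e x)^n C₀^a e^{-(3β/4) H(Z)}` (geometric series of
`abs_duhamelTerm_le_exp_mul_pow`) — the tail analogue of N4b `isLevelBdd_iterRem`, in the shape
`IsLevelBdd` consumed by `abs_blockComp_le`. [cite: BodineauGallagherSaintRaymondInvent2016, §4.4 (4.16), p. 13] -/
theorem isLevelBdd_tailOp {G : GCState d X} {R₀ C₀ β : ℝ} (hR₀ : 0 ≤ R₀) (hC₀ : 1 ≤ C₀) (hβ : 0 < β)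
    (hGb : ∀ (k : ℕ) (Z : Config k d X), |G k Z| ≤ R₀ * C₀ ^ k * exp (-β * configEnergy Z))
    {L n : ℕ} (hn : 1 ≤ n) (hLn : L ≤ n) (Nmax : ℕ) {h : ℝ} (hh : 0 ≤ h)
    (hex : exp 1 * (C₀ * M.pruneConst β * h) ≤ 1 / 2) :
    IsLevelBdd (M.tailOp n Nmax h G) L (2 * R₀ * (exp 1 * (C₀ * M.pruneConst β * h)) ^ n) C₀ (3 * β / 4) := by
  intro a ha Z
  have hC₀0 : 0 ≤ C₀ := zero_le_one.trans hC₀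
  set r := exp 1 * (C₀ * M.pruneConst β * h) with hr
  have hr0 : 0 ≤ r := by have := M.pruneConst_nonneg β; positivity
  rw [tailOp_apply]
  refine (Finset.abs_sum_le_sum_abs _ _).trans ?_
  calc ∑ m ∈ Finset.Ico n (Nmax + 1), |duhamelTerm M.transport M.op m a h G Z|
      ≤ ∑ m ∈ Finset.Ico n (Nmax + 1), R₀ * C₀ ^ a * r ^ m * exp (-(3 * β / 4) * configEnergy Z) := by
        refine Finset.sum_le_sum fun m hm => ?_
        have hm' : n ≤ m := (Finset.mem_Ico.1 hm).1
        exact abs_duhamelTerm_le_exp_mul_pow hR₀ hC₀ hβ hGb (hn.trans hm') (hLn.trans hm') ha hh Z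
    _ = R₀ * C₀ ^ a * exp (-(3 * β / 4) * configEnergy Z) * ∑ m ∈ Finset.Ico n (Nmax + 1), r ^ m := by
        rw [Finset.mul_sum]
        refine Finset.sum_congr rfl fun m _ => ?_
        ring
    _ ≤ R₀ * C₀ ^ a * exp (-(3 * β / 4) * configEnergy Z) * (2 * r ^ n) := by
        have h0 : 0 ≤ R₀ * C₀ ^ a * exp (-(3 * β / 4) * configEnergy Z) := by positivity
        exact mul_le_mul_of_nonneg_left (geom_sum_Ico_le_two_mul hr0 hex n (Nmax + 1)) h0
    _ = 2 * R₀ * r ^ n * C₀ ^ a * exp (-(3 * β / 4) * configEnergy Z) := by ring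

/-- **The blocks in front of a remainder (BGSR (4.16)–(4.17), block part).** For thresholds
`n_b = A^b` (`A ≥ 2`), a step `h ≥ 0` and `x = C₀ c_R h`, any family `Rem` bounded at the levels
`a ≤ L_i = pruneLevel A i` by `R C₀^a e^{-(3β/4) H}` satisfies
`|(blockComp i Rem)^{(1)}(Z)| ≤ R C₀ exp(3 x A^{i+1})`: `abs_blockComp_le` of N4b with the budgets
`β_b = (β/4) 2^{-(i-b)}`, each block factor being at most `exp(C₀ Λ_b h) ≤ exp(x A^{b+1} √2^{i-b})`
and `∑_{b<i} A^{b+1} √2^{i-b} ≤ 6 A^i ≤ 3 A^{i+1}` (the computation inside N4b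
`abs_blockComp_iterRem_le`, isolated). [cite: BodineauGallagherSaintRaymondInvent2016, §4.4 (4.16)-(4.17), pp. 13–14] -/
theorem abs_blockComp_le_exp {Rem : GCState d X} {R C₀ β : ℝ} (hR : 0 ≤ R) (hC₀ : 1 ≤ C₀) (hβ : 0 < β)
    {A : ℕ} (hA : 2 ≤ A) {h : ℝ} (hh0 : 0 ≤ h) (i : ℕ)
    (hrem : IsLevelBdd Rem (pruneLevel A i) R C₀ (3 * β / 4)) (Z : Config 1 d X) :
    |M.blockComp (pruneSeq A) h i Rem 1 Z| ≤
      R * C₀ * exp (3 * (C₀ * M.pruneConst β * h) * (A : ℝ) ^ (i + 1)) := by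
  have hA1 : 1 ≤ A := by omega
  have hC₀0 : 0 ≤ C₀ := zero_le_one.trans hC₀
  have hcR := M.pruneConst_nonneg β
  set x := C₀ * M.pruneConst β * h with hx
  have hx0 : 0 ≤ x := by positivity
  -- budgets `β_b = (β/4) 2^{-(i-b)}`
  set βs : ℕ → ℝ := fun b => β / 4 / 2 ^ (i - b) with hβs
  have hβs0 : ∀ b, 0 < βs b := fun b => by positivity
  have hbudget : β / 2 + ∑ b ∈ Finset.range i, βs b ≤ 3 * β / 4 := by
    have hsum : ∑ b ∈ Finset.range i, βs b = β / 4 * ∑ b ∈ Finset.range i, (1 / 2 : ℝ) ^ (i - b) := by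
      rw [Finset.mul_sum]
      refine Finset.sum_congr rfl fun b _ => ?_
      show β / 4 / 2 ^ (i - b) = β / 4 * (1 / 2) ^ (i - b)
      rw [one_div, inv_pow, div_eq_mul_inv]
    rw [hsum]
    nlinarith [sum_half_pow_le i, hβ]
  have hblk := M.abs_blockComp_le hA1 (half_pos hβ) hC₀ βs hβs0 hh0 i _ _ _ hR hbudget hrem Z
  refine hblk.trans ?_
  -- the block factors
  have hblock_le : ∀ b ∈ Finset.range i, ∑ j ∈ Finset.range (pruneSeq A b),
      (C₀ * M.chainCost (β / 2) (βs b / pruneSeq A b) (pruneLevel A (b + 1)) * h) ^ j / j ! ≤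
        exp (x * ((A : ℝ) ^ (b + 1) * sqrt 2 ^ (i - b))) := by
    intro b _
    have hnb : (0 : ℝ) < pruneSeq A b := by exact_mod_cast one_le_pruneSeq hA1 b
    have hq : (1 : ℝ) ≤ sqrt 2 ^ (i - b) := one_le_pow₀ Real.one_lt_sqrt_two.le
    have hΛb : M.chainCost (β / 2) (βs b / pruneSeq A b) (pruneLevel A (b + 1)) ≤
        M.pruneConst β * pruneSeq A b * sqrt 2 ^ (i - b) := by
      refine M.chainCost_le hβ hq hnb (le_of_eq ?_) ?_
      · show β / 4 / (pruneSeq A b * (sqrt 2 ^ (i - b)) ^ 2) = β / 4 / 2 ^ (i - b) / pruneSeq A b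
        rw [← pow_mul, mul_comm (i - b) 2, pow_mul, sq_sqrt zero_le_two]
        field_simp
      · have := pruneLevel_succ_le hA b
        have h' : ((pruneLevel A (b + 1) : ℕ) : ℝ) ≤ ((2 * A ^ (b + 1) : ℕ) : ℝ) := by exact_mod_cast this
        simpa [pruneSeq_apply] using h'
    have h0 : 0 ≤ C₀ * M.chainCost (β / 2) (βs b / pruneSeq A b) (pruneLevel A (b + 1)) * h := by
      have := M.chainCost_nonneg (β / 2) (βs b / pruneSeq A b) (pruneLevel A (b + 1))
      positivity
    refine (Real.sum_le_exp_of_nonneg h0 _).trans (exp_le_exp.2 ?_)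
    calc C₀ * M.chainCost (β / 2) (βs b / pruneSeq A b) (pruneLevel A (b + 1)) * h
        ≤ C₀ * (M.pruneConst β * pruneSeq A b * sqrt 2 ^ (i - b)) * h := by gcongr
      _ = x * ((A : ℝ) ^ (b + 1) * sqrt 2 ^ (i - b)) := by
          rw [hx, pruneSeq_apply]; push_cast; ring
  have hprod_le : ∏ b ∈ Finset.range i, ∑ j ∈ Finset.range (pruneSeq A b),
      (C₀ * M.chainCost (β / 2) (βs b / pruneSeq A b) (pruneLevel A (b + 1)) * h) ^ j / j ! ≤
        exp (3 * x * (A : ℝ) ^ (i + 1)) := by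
    calc ∏ b ∈ Finset.range i, ∑ j ∈ Finset.range (pruneSeq A b),
          (C₀ * M.chainCost (β / 2) (βs b / pruneSeq A b) (pruneLevel A (b + 1)) * h) ^ j / j !
        ≤ ∏ b ∈ Finset.range i, exp (x * ((A : ℝ) ^ (b + 1) * sqrt 2 ^ (i - b))) := by
          refine Finset.prod_le_prod (fun b _ => Finset.sum_nonneg fun j _ => ?_) hblock_le
          have := M.chainCost_nonneg (β / 2) (βs b / pruneSeq A b) (pruneLevel A (b + 1))
          positivity
      _ = exp (x * ∑ b ∈ Finset.range i, (A : ℝ) ^ (b + 1) * sqrt 2 ^ (i - b)) := by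
          rw [Finset.mul_sum, Real.exp_sum]
      _ ≤ exp (3 * x * (A : ℝ) ^ (i + 1)) := by
          refine exp_le_exp.2 ?_
          have hs := sum_pow_mul_sqrt_two_pow_le hA i
          have hA2 : (2 : ℝ) ≤ A := by exact_mod_cast hA
          have hAi : (0 : ℝ) ≤ (A : ℝ) ^ i := by positivity
          calc x * ∑ b ∈ Finset.range i, (A : ℝ) ^ (b + 1) * sqrt 2 ^ (i - b) ≤ x * (6 * (A : ℝ) ^ i) :=
                mul_le_mul_of_nonneg_left hs hx0
            _ ≤ x * (3 * (A : ℝ) ^ (i + 1)) := by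
                refine mul_le_mul_of_nonneg_left ?_ hx0
                rw [pow_succ]
                nlinarith
            _ = 3 * x * (A : ℝ) ^ (i + 1) := by ring
  have h0 : 0 ≤ R * C₀ := by positivity
  calc R * C₀ * ∏ b ∈ Finset.range i, ∑ j ∈ Finset.range (pruneSeq A b),
        (C₀ * M.chainCost (β / 2) (βs b / pruneSeq A b) (pruneLevel A (b + 1)) * h) ^ j / j !
      ≤ R * C₀ * exp (3 * x * (A : ℝ) ^ (i + 1)) := mul_le_mul_of_nonneg_left hprod_le h0

/-- `e x ≤ 1/2` under the step condition `x ≤ γ/e²`, `γ ≤ 1` (since `e > 2`). [folklore] -/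
theorem exp_one_mul_le_half {x γ : ℝ} (hx : 0 ≤ x) (hxγ : x ≤ γ / exp 2) (hγ1 : γ ≤ 1) :
    exp 1 * x ≤ 1 / 2 := by
  have he : (2 : ℝ) < exp 1 := by
    have := Real.add_one_lt_exp (x := (1 : ℝ)) one_ne_zero
    linarith
  have he0 : 0 < exp 1 := exp_pos 1
  have he2 : exp 2 = exp 1 * exp 1 := by rw [← exp_add]; norm_num
  have hγ0 : 0 ≤ γ := by
    have h := hx.trans hxγ
    rw [le_div_iff₀ (exp_pos 2)] at h
    nlinarith [exp_pos (2 : ℝ)]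
  calc exp 1 * x ≤ exp 1 * (γ / exp 2) := by gcongr
    _ = γ / exp 1 := by rw [he2]; field_simp
    _ ≤ 1 / exp 1 := by gcongr
    _ ≤ 1 / 2 := by
        rw [div_le_div_iff₀ he0 two_pos]
        linarith

/-- **One term of the remainder, tail form (BGSR (4.16)–(4.17)).** Let `P` obey the a priori
bound `|P^{(k)}(Z)| ≤ R₀ C₀^k e^{-β H_k(Z)}` (BGSR (4.6)/(4.7)), let `A ≥ 2`, `n_k = A^k`, `γ ≤ 1`,
and let the step `h ≥ 0` satisfy `C₀ c_R h ≤ γ/e²`. Then the term `i` of the remainder in tail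
form — `i` blocks of fewer than `n_1, …, n_i` collisions followed by at least `n_{i+1}`
collisions in the block built on `P` — satisfies
`|(blockComp i [tailOp n_{i+1} [P]])^{(1)}(Z)| ≤ 2 R₀ C₀ γ^{A^{i+1}}` (N4b
`abs_blockComp_iterRem_le` with the remainder slot `isLevelBdd_tailOp`; the factor `2` is the
geometric tail). [cite: BodineauGallagherSaintRaymondInvent2016, §4.4 Prop. 4.3 (4.16)-(4.17), pp. 13–14] -/
theorem abs_blockComp_tailOp_le {P : GCState d X} {R₀ C₀ β : ℝ} (hR₀ : 0 ≤ R₀) (hC₀ : 1 ≤ C₀)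
    (hβ : 0 < β) (hPb : ∀ (k : ℕ) (Z : Config k d X), |P k Z| ≤ R₀ * C₀ ^ k * exp (-β * configEnergy Z))
    {A : ℕ} (hA : 2 ≤ A) {γ : ℝ} (hγ1 : γ ≤ 1) {h : ℝ} (hh0 : 0 ≤ h)
    (hsmall : C₀ * M.pruneConst β * h ≤ γ / exp 2) (Nmax i : ℕ) (Z : Config 1 d X) :
    |M.blockComp (pruneSeq A) h i (M.tailOp (pruneSeq A i) Nmax h P) 1 Z| ≤
      2 * R₀ * C₀ * γ ^ pruneSeq A i := by
  have hA1 : 1 ≤ A := by omega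
  have hC₀0 : 0 ≤ C₀ := zero_le_one.trans hC₀
  have hcR := M.pruneConst_nonneg β
  set n := pruneSeq A i with hn_def
  set x := C₀ * M.pruneConst β * h with hx
  have hx0 : 0 ≤ x := by positivity
  have hn1 : 1 ≤ n := one_le_pruneSeq hA1 i
  have hnA : (n : ℝ) = (A : ℝ) ^ (i + 1) := by rw [hn_def, pruneSeq_apply]; push_cast; ring
  have hex : exp 1 * x ≤ 1 / 2 := exp_one_mul_le_half hx0 hsmall hγ1
  have hrem := isLevelBdd_tailOp (M := M) hR₀ hC₀ hβ hPb hn1 (pruneLevel_le_pruneSeq hA i) Nmax hh0 hex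
  have hR : 0 ≤ 2 * R₀ * (exp 1 * x) ^ n := by positivity
  have hblk := abs_blockComp_le_exp (M := M) hR hC₀ hβ hA hh0 i hrem Z
  refine hblk.trans ?_
  rw [← hnA]
  have hkey : exp 1 * x * exp (3 * x) ≤ γ := exp_one_mul_mul_exp_le hx0 hsmall hγ1
  have hkey0 : 0 ≤ exp 1 * x * exp (3 * x) := by positivity
  calc 2 * R₀ * (exp 1 * x) ^ n * C₀ * exp (3 * x * n)
      = 2 * R₀ * C₀ * (exp 1 * x * exp (3 * x)) ^ n := by
        rw [mul_pow, show 3 * x * n = (n : ℝ) * (3 * x) by ring, Real.exp_nat_mul]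
        ring
    _ ≤ 2 * R₀ * C₀ * γ ^ n := by gcongr

/-- **BGSR Proposition 4.3, (4.14), tail form: the remainder is `O(γ^A)`.** Under the a priori
bound on the families `P_i` feeding the tails of the `K` blocks (one family per block time),
thresholds `n_k = A^k` (`A ≥ 2`), `0 ≤ γ ≤ 1/2` and the step condition `C₀ c_R h ≤ γ/e²`,
`|∑_{i<K} (blockComp i [tailOp n_{i+1} [P_i]])^{(1)}(Z)| ≤ 4 γ^A R₀ C₀` at every `Z`
(`abs_blockComp_tailOp_le` and `∑_i γ^{A^{i+1}} ≤ 2 γ^A`). [cite: BodineauGallagherSaintRaymondInvent2016, §4.4 Prop. 4.3 (4.13)-(4.14), p. 13] -/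
theorem abs_tailRemainder_le {P : ℕ → GCState d X} {R₀ C₀ β : ℝ} (hR₀ : 0 ≤ R₀) (hC₀ : 1 ≤ C₀)
    (hβ : 0 < β) (K : ℕ)
    (hPb : ∀ i < K, ∀ (k : ℕ) (Z : Config k d X), |P i k Z| ≤ R₀ * C₀ ^ k * exp (-β * configEnergy Z))
    {A : ℕ} (hA : 2 ≤ A) {γ : ℝ} (hγ0 : 0 ≤ γ) (hγ : γ ≤ 1 / 2) {h : ℝ} (hh0 : 0 ≤ h)
    (hsmall : C₀ * M.pruneConst β * h ≤ γ / exp 2) (Nmax : ℕ) (Z : Config 1 d X) :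
    |∑ i ∈ Finset.range K, M.blockComp (pruneSeq A) h i (M.tailOp (pruneSeq A i) Nmax h (P i)) 1 Z| ≤
      4 * γ ^ A * R₀ * C₀ := by
  have hC₀0 : 0 ≤ C₀ := zero_le_one.trans hC₀
  have hγ1 : γ ≤ 1 := hγ.trans (by norm_num)
  refine (Finset.abs_sum_le_sum_abs _ _).trans ?_
  calc ∑ i ∈ Finset.range K, |M.blockComp (pruneSeq A) h i (M.tailOp (pruneSeq A i) Nmax h (P i)) 1 Z|
      ≤ ∑ i ∈ Finset.range K, 2 * R₀ * C₀ * γ ^ pruneSeq A i :=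
        Finset.sum_le_sum fun i hi =>
          abs_blockComp_tailOp_le (M := M) hR₀ hC₀ hβ (hPb i (Finset.mem_range.1 hi)) hA hγ1 hh0
            hsmall Nmax i Z
    _ = 2 * R₀ * C₀ * ∑ i ∈ Finset.range K, γ ^ pruneSeq A i := by rw [Finset.mul_sum]
    _ ≤ 2 * R₀ * C₀ * (2 * γ ^ A) := by
        have := sum_pow_pruneSeq_le hA hγ0 hγ K
        have h0 : 0 ≤ 2 * R₀ * C₀ := by positivity
        exact mul_le_mul_of_nonneg_left this h0
    _ = 4 * γ ^ A * R₀ * C₀ := by ring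

variable {μ : (s : ℕ) → Measure (Config s d X)}

/-- **BGSR Proposition 4.3 for the finite Duhamel series, almost everywhere.** Let the
transports of `M` form groups everywhere, let `f₀` be nice and vanish above level `Nmax`, and let
the Duhamel terms of `M` respect `μ`-null sets. Let `P` be a family of time-dependent densities
obeying the a priori bound `|P^{(k)}(τ, Z)| ≤ R₀ C₀^k e^{-β H_k(Z)}` with measurable slices on
`[0, T]` (for hard spheres: the marginals of the transported density and the maximum principle
(4.6), BGSR Prop. 4.1), and suppose that at the block times `t_i = Kh - (i+1)h` the series family
`F` agrees with `P(t_i)` up to `μ`-null sets, level by level. Then with thresholds `n_k = A^k`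
(`A ≥ 2`), `0 ≤ γ ≤ 1/2`, `Kh ≤ T` and the step condition `C₀ c_R h ≤ γ/e²` of N4b,
`|F^{(1)}(Kh) - (blockComp K [F(0)])^{(1)}| ≤ 4 γ^A R₀ C₀` holds `μ_1`-almost everywhere
(`seriesFamily_ae_eq_blockComp_add` and `abs_tailRemainder_le`). This is the form in which
Prop. 4.3 is available for the BBGKY hierarchy of the hard-sphere system, whose Duhamel series
carries no pointwise a priori bound of its own. [cite: BodineauGallagherSaintRaymondInvent2016, §4.4 Prop. 4.3 (4.14), p. 13] -/
theorem seriesFamily_ae_abs_sub_blockComp_le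
    (hflow : ∀ (s : ℕ) (a b : ℝ) (Z : Config s d X), M.flow s (a + b) Z = M.flow s a (M.flow s b Z))
    {Nmax : ℕ} {f₀ : GCState d X} (hf₀ : ∀ k, IsNice (f₀ k)) (hvan : ∀ k, Nmax < k → f₀ k = 0)
    (hR : M.RespectsAE μ) {T : ℝ} {P : (s : ℕ) → ℝ → Config s d X → ℝ}
    (hPm : ∀ (k : ℕ), ∀ τ ∈ Icc 0 T, Measurable (P k τ))
    {R₀ C₀ β : ℝ} (hR₀ : 0 ≤ R₀) (hC₀ : 1 ≤ C₀) (hβ : 0 < β)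
    (hPb : ∀ (k : ℕ), ∀ τ ∈ Icc 0 T, ∀ Z : Config k d X,
      |P k τ Z| ≤ R₀ * C₀ ^ k * exp (-β * configEnergy Z))
    {A : ℕ} (hA : 2 ≤ A) {γ : ℝ} (hγ0 : 0 ≤ γ) (hγ : γ ≤ 1 / 2) {h : ℝ} (hh0 : 0 ≤ h)
    (hsmall : C₀ * M.pruneConst β * h ≤ γ / exp 2) (K : ℕ) (hKT : K * h ≤ T)
    (hS : ∀ i < K, ∀ k,
      M.seriesFamily Nmax f₀ k (K * h - (i + 1) * h) =ᵐ[μ k] P k (K * h - (i + 1) * h)) :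
    ∀ᵐ Z ∂(μ 1), |M.seriesFamily Nmax f₀ 1 (K * h) Z -
        M.blockComp (pruneSeq A) h K (fun a => M.seriesFamily Nmax f₀ a 0) 1 Z| ≤ 4 * γ ^ A * R₀ * C₀ := by
  -- block times lie in `[0, T]`
  have hti : ∀ i < K, K * h - (i + 1) * h ∈ Icc 0 T := by
    intro i hi
    have : (i + 1 : ℝ) ≤ K := by exact_mod_cast hi
    refine ⟨by nlinarith, ?_⟩
    nlinarith [mul_nonneg (by positivity : (0 : ℝ) ≤ i + 1) hh0]
  have hP : ∀ i < K, ∀ k, IsNice (P k (K * h - (i + 1) * h)) := fun i hi k =>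
    ⟨hPm k _ (hti i hi), R₀ * C₀ ^ k, β, hβ, hPb k _ (hti i hi)⟩
  have hae := seriesFamily_ae_eq_blockComp_add hflow hf₀ hvan hR (pruneSeq A) hh0 K hP hS
  filter_upwards [hae] with Z hZ
  rw [hZ, add_sub_cancel_left]
  exact abs_tailRemainder_le (M := M) (P := fun i k => P k (K * h - (i + 1) * h)) hR₀ hC₀ hβ K
    (fun i hi k Z' => hPb k _ (hti i hi) Z') hA hγ0 hγ hh0 hsmall Nmax Z

end Estimates

end HierarchyModel

end Kinetic

end

end Literature.MathematicalPhysics.KineticTheory
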